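import Mathlib
import HarnessLib
import Summits.HubbardSuperconductivity.HubbardSuperconductivity.Theorems.KLProgrammeKLRegimeEngineTowerModelDefsWtFull
import Summits.HubbardSuperconductivity.HubbardSuperconductivity.Theorems.KLProgrammeKLRegimeEngineTowerRemeasureNarrowWideSplitWtAll

/-!
# Route `KLProgramme` — crux K3 ENGINE (stmt-HubbardSuperconductivity-20437 `KLRegimeEngineV17F2`), stub (b) v2, THE LEVELS PACKAGE (ℓ), (I2) weighted track:
# THE NARROW / WIDE ROW ON THE TOWER'S ARRAYS (`klTowerBornWtAt` off the class, the weighted all-known array `klTowerBornWtFull` on it) AT THE FLOW FRAME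
# WITH NO DEPTH WINDOW — the `_flow_all` re-key (X3) of `klWtPinnedSumAt_klTowerIncr_narrowWideSplit_le_klEng_flow_deep` (…EngineTowerModelDefsWtFull §2)
# (located item «(I2)-WT-WINDOW»; cell gate-hubbard-kl, seat p4 g17, owner k3c2-p3's concurrence 15:43Z)

`…EngineTowerModelDefsWtFull` §2 (k3c2-p3 g11) instantiates the narrow/wide weighted jump on the tower's own increments on p3's deep window
`4ⁿ·U ≤ 4^{2(dk′+1)+dd}` in the BORN block `k′` — no supplier for old increments at deep frames.  This file is the same instantiation over the window-free
`klWtPinnedSumAt_jump_le_narrowWideSplit_klEng_flow_all (m) (hm) (R) (c″)` (…EngineTowerRemeasureNarrowWideSplitWtAll): the window binder is GONE, the `FrameOK`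
binder is derived from the history, W5's extra binders (`c″U ≤ 1`, `IsKLRegime U cc (−n)`, the REGISTERED (K5′) clauses) are added; the definition
`klTowerBornWtFull` and its rows are read BY NAME (no definition here).

* **`klWtPinnedSumAt_klTowerIncr_narrowWideSplit_le_klEng_flow_all (m) (hm : 3 ≤ m) (R) (c″)`** — `Δ_{k′}` re-measured at `F_{dk−1}` (rate `j ≥ dk − 1`), every
  `k′ < k` with `k₀ ≤ dk′`, `dk − 1 ≤ n`: off the class against `klTowerBornWtAt … d k′ j (m+1)`, on the narrow class against `klTowerBornWtFull … d k′ (m+1)` times the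
  narrow multiplicity — the same right-hand side as the `_flow_deep` row.
Everything is proved; no definitions; nothing about the model is asserted; nothing asserts superconductivity.
References: BGM 2006 §2.8 (2.82)–(2.84), (2.88)–(2.90), §3 (3.2)–(3.8), App. A3 [cite: BenfattoGiulianiMastropietro2006].
-/

noncomputable section

namespace Summit.HubbardSuperconductivity.HubbardSuperconductivity.Theorems.EngineV8

set_option linter.dupNamespace false -- summit = problem name (single-conjunct summit), D-0017

open Classical
open Real Finset Literature.MathematicalPhysics.QuantumLattice Literature.Probability.LatticeModels GrassmannAlgebra
open Literature.MathematicalPhysics.QuantumLattice.FermiRG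
open Summit.HubbardSuperconductivity.HubbardSuperconductivity.Theorems.KLRegimeSplit
open Summit.HubbardSuperconductivity.HubbardSuperconductivity.Theorems.KLProgrammeLegKernels
open Summit.HubbardSuperconductivity.HubbardSuperconductivity.Theorems.DispersionFlow
open Summit.HubbardSuperconductivity.HubbardSuperconductivity.Theorems.PerturbedFermiCurve
open Summit.HubbardSuperconductivity.HubbardSuperconductivity.Theorems.TorusFourierL2

/-! ## The weighted narrow / wide row on the tower's arrays, no window -/

variable {L M : ℕ} [NeZero L] [NeZero M]

/-- **THE INCREMENT `Δ_{k′}` RE-MEASURED AT `F_{dk−1}` (weighted track, rate `j ≥ dk−1`, flow frame, NO depth window), NARROW / WIDE SPLIT, ON THE TOWER'S ARRAYS**: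
off the class E1's rate-`j` weighted born array `klTowerBornWtAt … d k′ j (m+1)`, on the narrow class the weighted all-known array `klTowerBornWtFull … d k′ (m+1)` times
the narrow multiplicity (`m + 1 ≥ 4` legs). [cite: BenfattoGiulianiMastropietro2006, §2.8 (2.82)-(2.84), (2.88)-(2.90), App. A3] -/
theorem klWtPinnedSumAt_klTowerIncr_narrowWideSplit_le_klEng_flow_all (m : ℕ) (hm : 3 ≤ m) (R : RenConsts) (c'' : ℝ) (hc'' : 0 ≤ c'') :
    ∃ Cm : ℝ, 0 < Cm ∧ ∃ C : ℝ, 0 < C ∧ ∃ D₁ : ℝ, 0 < D₁ ∧ ∃ Cw : ℝ, 0 < Cw ∧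
      ∃ c₂ cb K₁ K₂ c₀ c₂' : ℝ, 0 ≤ c₂ ∧ 0 < cb ∧ 2 + c₂ ≤ K₁ ∧ 0 < K₂ ∧ 0 < c₀ ∧ 0 < c₂' ∧
      ∃ D₂ : ℝ, 0 < D₂ ∧ ∃ k₀ : ℕ,
      (R.WF2 → ∃ c₃ : ℝ, 0 < c₃ ∧ ∃ U₀ : ℝ, 0 < U₀ ∧ ∃ Λ : ℝ, 0 ≤ Λ ∧ ∃ r₀ : ℝ, 0 < r₀ ∧ ∃ v₀ : ℝ, 0 < v₀ ∧
      ∀ (G : GeoConsts) (P : SplitConsts) (Q : EngConsts) (cc : ℝ), 0 < cc → cc ≤ klEngC₃6 P R → cc ≤ c₃ →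
      ∀ μ ∈ klWindowC, ∀ U : ℝ, 0 < U → U ≤ min (klEngU₀3 P R cc) (1 / (R.Gfr 3 + 1)) → U ≤ U₀ → c'' * U ≤ 1 →
      ∀ β : ℝ, klBetaMin ≤ β → β ≤ Real.exp (cc / U ^ 2) →
      ∀ (L M : ℕ) [NeZero L] [NeZero M], klEngL₃ β U ≤ L → klEngM₃ β U L ≤ M →
      ∀ n : ℕ, 1 ≤ n → n ≤ nScales β + 1 → IsKLRegime U cc (-(n : ℤ)) → HistP klPredsV17F2 L M G P Q R β U μ 0 n →
        (∀ m', 1 ≤ m' → m' < n → FlowPieceOscAt L M c'' β U μ m') →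
        ∀ d k k' : ℕ, 2 ≤ d → k' < k → k₀ ≤ d * k' → d * k - 1 ≤ n →
      ∀ (Θ LΨ Bfib : ℝ), LΨ = (m + 1 : ℕ) + c₂ * (π / 2 + 5 * sectorWidth (d * k')) / (K₁ * Θ) → (2 : ℝ) ^ (-((d * k - 1 : ℕ) : ℤ)) ≤ Θ →
        cb * (2 : ℝ) ^ (-((d * k - 1 : ℕ) : ℤ)) ≤ Θ → K₂ * LΨ * (cb * (2 : ℝ) ^ (-((d * k - 1 : ℕ) : ℤ))) ≤ c₂' * Θ →
        max ((2 * ((2 * c₀ * K₂ * cb / π + 1) * LΨ)) ^ 2) (4 * cb ^ 2 * K₂ ^ 2 / 1 ^ 2 * LΨ ^ 2) ≤ Bfib →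
      ((m : ℝ) + 1) * (Cw + C) * sectorWidth (d * k') < 2 * π →
      (((m : ℝ) + 1) * C + m * Λ * (⌊(Θ + 5 * sectorWidth (d * k')) / sectorWidth (d * k')⌋₊ : ℕ)) * sectorWidth (d * k') < v₀ →
      ((m : ℝ) + 1) * C * sectorWidth (d * k') < π →
        ∀ j : ℕ, d * k - 1 ≤ j → ∀ (q : Fin (m + 1)) (w : SpaceTimeIdx L M × SectorLeg (sectorCount (d * k - 1))),
          klWtPinnedSumAt L M β μ (klFlowFrameU L M β U μ n) (d * k - 1) j (m + 1) (klTowerIncr L M β U μ (klFlowFrameU L M β U μ n) d k') q w ≤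
            Cm * ((27 : ℝ) * (D₁ ^ (m + 1) + (5 : ℝ) ^ (m + 1) * ((m + 1 : ℕ) ^ 2 * (Bfib * 3 ^ (m - 2)))) * ((2 : ℝ) ^ (d * k - 1 - d * k')) ^ (m - 2) *
                klTowerBornWtAt L M β U μ (klFlowFrameU L M β U μ n) d k' j (m + 1) +
              D₂ * 27 ^ (m + 1) * ((2 : ℝ) ^ (d * k - 1 - d * k')) ^ (m - 1) *
                ((2 * ((m : ℝ) + 1) + 1) ^ 2 * (2 * (8 * π * (((m : ℝ) + 1) * C + m * Λ *
                  (⌊(Θ + 5 * sectorWidth (d * k')) / sectorWidth (d * k')⌋₊ : ℕ)) / r₀ + 2) *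
                  (8 * (2 * ((⌊(Θ + 5 * sectorWidth (d * k')) / sectorWidth (d * k')⌋₊ : ℕ) : ℝ) + 1)) ^ m)) *
                klTowerBornWtFull L M β U μ (klFlowFrameU L M β U μ n) d k' (m + 1))) := by
  obtain ⟨Cm, hCm, C, hC, D₁, hD₁, Cw, hCw, c₂, cb, K₁, K₂, c₀, c₂', h1, h2, h3, h4, h5, h6, D₂, hD₂, k₀, h⟩ :=
    klWtPinnedSumAt_jump_le_narrowWideSplit_klEng_flow_all m hm R c'' hc''
  refine ⟨Cm, hCm, C, hC, D₁, hD₁, Cw, hCw, c₂, cb, K₁, K₂, c₀, c₂', h1, h2, h3, h4, h5, h6, D₂, hD₂, k₀, fun hR2 => ?_⟩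
  obtain ⟨c₃, hc₃, U₀, hU₀, Λ, hΛ, r₀, hr₀, v₀, hv₀, h'⟩ := h hR2
  refine ⟨c₃, hc₃, U₀, hU₀, Λ, hΛ, r₀, hr₀, v₀, hv₀, ?_⟩
  intro G P Q cc hcc hcc6 hccm μ hμ U hU hUle hUm hcU β hβmin hβc L M _ _ hL3 hM3 n hn1 hnN hkl hhist hosc d k k' hd hk hk₀ hkn Θ LΨ Bfib hLΨ hΘt hΘδ hΘη hBfib
    hsmall hsmallv hπC j hj q w
  have hβ : 0 < β := KLRegimeSplit.pos_of_klBetaMin_le hβmin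
  have hjk : d * k' ≤ j := by have := block_jump_le hd hk; omega
  exact h' G P Q cc hcc hcc6 hccm μ hμ U hU hUle hUm hcU β hβmin hβc L M hL3 hM3 n hn1 hnN hkl hhist hosc (d * k') (d * k - 1) hk₀ (block_jump_le hd hk) hkn
    Θ LΨ Bfib hLΨ hΘt hΘδ hΘη hBfib hsmall hsmallv hπC (klTowerIncr L M β U μ _ d k') (fun m' X hX => klTowerIncr_momentumConserving β U μ _ d k' m' X hX)
    j hj q w (klTowerBornWtAt L M β U μ _ d k' j (m + 1)) (klTowerBornWtFull L M β U μ _ d k' (m + 1))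
    (klTowerBornWtAt_nonneg hβ.le U μ _ d k' j (m + 1)) (klTowerBornWtFull_nonneg hβ.le U μ _ d k' (m + 1))
    (fun w' => klWtPinnedSumAt_le_klTowerBornWtAt β U μ _ d k' j (m + 1) q w')
    (fun σ' y' => pinnedTupleWtSum_rate_le_klTowerBornWtFull hβ.le U μ _ d k' m hjk q σ' y')

end Summit.HubbardSuperconductivity.HubbardSuperconductivity.Theorems.EngineV8

end
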